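import Literature.Analysis.SingularIntegrals.SchurTest
import Mathlib.MeasureTheory.Integral.IntegralEqImproper
import Mathlib.MeasureTheory.Function.JacobianOneDim
import Mathlib.Analysis.SpecialFunctions.Trigonometric.ArctanDeriv
import Mathlib.Analysis.SpecialFunctions.Pow.Deriv
import Mathlib.Analysis.SpecialFunctions.ImproperIntegrals

/-!
# Hilbert's inequality: the Carleman operator `(x + y)⁻¹` has `L²(0,∞)` norm at most `π`

Topic `Literature/Analysis/SingularIntegrals` (next to `SchurTest`).  Hardy–Littlewood–Pólya, *Inequalities*,
Thm. 316 (Hilbert's double-series / double-integral theorem, integral form, `p = 2`):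
`∫₀^∞∫₀^∞ f(x) g(y)/(x+y) dx dy ≤ π ‖f‖₂ ‖g‖₂`, equivalently the positive operator
`(Kf)(x) = ∫₀^∞ f(y)/(x+y) dy` satisfies `‖Kf‖₂ ≤ π ‖f‖₂`.  Proof by **Schur's test** (tree:
`Literature.Analysis.SingularIntegrals.lintegral_rpow_lintegral_le_of_schur`) with the test function `y^{-1/4}`:
the row integral is `∫₀^∞ (x+y)⁻¹ y^{-1/2} dy = π x^{-1/2}` (substitution `y = t²`, then `∫₀^∞ 2/(x+t²) dt = π/√x`
by the arctangent primitive).  Everything in `ℝ≥0∞` / `lintegral` form for measurable `f, g ≥ 0`; sharpness of `π`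
is not proved.  Motivation in this tree: the Hilbert-type form `B = Re ∫_{u<u₀} Z²` of the radiation-side channel
forms (`Literature/Analysis/Fourier/OneSidedSpectrumRadiationForms.lean`) is a Carleman form in the spectral variable,
whence `|B| ≤ E/2`.

* `integral_Ioi_two_div_add_sq`, `lintegral_Ioi_two_div_add_sq` — `∫₀^∞ 2/(x+t²) dt = π/√x`;
* `lintegral_Ioi_inv_add_mul_rpow_neg_half` — `∫₀^∞ (x+y)⁻¹ y^{-1/2} dy = π x^{-1/2}`;
* `lintegral_Ioi_carleman_rpow_two_le` — `∫₀^∞ (∫₀^∞ f(y)/(x+y) dy)² dx ≤ π² ∫₀^∞ f²`;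
* `lintegral_Ioi_lintegral_Ioi_mul_mul_inv_add_le` — the bilinear form `≤ π ‖f‖₂ ‖g‖₂`;
* `lintegral_Ioi_laplace_sq_eq`, `lintegral_Ioi_laplace_sq_le` — `‖𝓛f‖₂² = ∬ f f′/(x+y) ≤ π ‖f‖₂²` (the Laplace transform is
  bounded on `L²(0,∞)` with norm `√π`).

References: G. H. Hardy, J. E. Littlewood, G. Pólya, *Inequalities*, 2nd ed., CUP 1952, Thm. 316 [HardyLittlewoodPolya1952];
L. Grafakos, *Modern Fourier Analysis*, App. A.2 (Schur's test) [Grafakos2009].  No definitions; all proved.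
-/

noncomputable section

open MeasureTheory Set Filter Real
open scoped ENNReal Topology

namespace Literature.Analysis.SingularIntegrals

/-- The arctangent primitive: for `x > 0`, `∫₀^∞ 2/(x + t²) dt = π/√x`, and the integrand is integrable. [folklore] -/
theorem integral_Ioi_two_div_add_sq {x : ℝ} (hx : 0 < x) :
    IntegrableOn (fun t : ℝ => 2 / (x + t ^ 2)) (Ioi 0) ∧ ∫ t in Ioi (0 : ℝ), 2 / (x + t ^ 2) = π / Real.sqrt x := by
  have hsx : 0 < Real.sqrt x := Real.sqrt_pos.mpr hx
  set g : ℝ → ℝ := fun t => 2 / Real.sqrt x * Real.arctan (t / Real.sqrt x) with hg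
  have hderiv : ∀ t : ℝ, HasDerivAt g (2 / (x + t ^ 2)) t := by
    intro t
    have h1 : HasDerivAt (fun t : ℝ => t / Real.sqrt x) (1 / Real.sqrt x) t := by
      simpa using (hasDerivAt_id t).div_const (Real.sqrt x)
    have h2 := ((Real.hasDerivAt_arctan (t / Real.sqrt x)).comp t h1).const_mul (2 / Real.sqrt x)
    refine h2.congr_deriv ?_
    have hs2 : Real.sqrt x ^ 2 = x := Real.sq_sqrt hx.le
    field_simp
    rw [hs2]
  have hlim : Tendsto g atTop (𝓝 (2 / Real.sqrt x * (π / 2))) := by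
    refine Tendsto.const_mul _ ?_
    have h := (Real.tendsto_arctan_atTop.mono_right nhdsWithin_le_nhds).comp (tendsto_id.atTop_div_const hsx)
    exact h
  have hcont : ContinuousWithinAt g (Ici 0) 0 :=
    ((continuous_const.mul (Real.continuous_arctan.comp (continuous_id.div_const _))).continuousAt).continuousWithinAt
  have hpos : ∀ t ∈ Ioi (0 : ℝ), 0 ≤ 2 / (x + t ^ 2) := fun t _ => by positivity
  refine ⟨integrableOn_Ioi_deriv_of_nonneg hcont (fun t _ => hderiv t) hpos hlim, ?_⟩
  rw [integral_Ioi_of_hasDerivAt_of_nonneg hcont (fun t _ => hderiv t) hpos hlim]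
  simp only [hg, zero_div, Real.arctan_zero, mul_zero, sub_zero]
  field_simp

/-- The same in `ℝ≥0∞` form: `∫⁻_{(0,∞)} 2/(x + t²) dt = π/√x`. [folklore] -/
theorem lintegral_Ioi_two_div_add_sq {x : ℝ} (hx : 0 < x) :
    ∫⁻ t in Ioi (0 : ℝ), ENNReal.ofReal (2 / (x + t ^ 2)) = ENNReal.ofReal (π / Real.sqrt x) := by
  obtain ⟨hint, hval⟩ := integral_Ioi_two_div_add_sq hx
  rw [← hval, ofReal_integral_eq_lintegral_ofReal hint]
  exact (ae_restrict_mem measurableSet_Ioi).mono fun t _ => by positivity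

/-- **The Schur row integral of the Carleman kernel**: for `x > 0`,
`∫₀^∞ (x + y)⁻¹ y^{-1/2} dy = π x^{-1/2}` (substitute `y = t²`). [folklore] -/
theorem lintegral_Ioi_inv_add_mul_rpow_neg_half {x : ℝ} (hx : 0 < x) :
    ∫⁻ y in Ioi (0 : ℝ), ENNReal.ofReal ((x + y)⁻¹) * ENNReal.ofReal (y ^ (-(1 / 2 : ℝ))) =
      ENNReal.ofReal (π * x ^ (-(1 / 2 : ℝ))) := by
  have himg : (fun t : ℝ => t ^ 2) '' Ioi 0 = Ioi 0 := by
    ext y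
    constructor
    · rintro ⟨t, ht, rfl⟩
      exact pow_pos (mem_Ioi.mp ht) 2
    · intro hy
      exact ⟨Real.sqrt y, Real.sqrt_pos.mpr hy, Real.sq_sqrt hy.le⟩
  have hinj : InjOn (fun t : ℝ => t ^ 2) (Ioi 0) := by
    intro a ha b hb hab
    simp only at hab
    nlinarith [mem_Ioi.mp ha, mem_Ioi.mp hb, sq_nonneg (a - b), sq_nonneg (a + b)]
  have hder : ∀ t ∈ Ioi (0 : ℝ), HasDerivWithinAt (fun t : ℝ => t ^ 2) (2 * t) (Ioi 0) t := fun t _ => by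
    simpa using (hasDerivAt_pow 2 t).hasDerivWithinAt
  rw [← himg, lintegral_image_eq_lintegral_abs_deriv_mul measurableSet_Ioi hder hinj]
  have hpt : ∀ t ∈ Ioi (0 : ℝ), ENNReal.ofReal |2 * t| *
      (ENNReal.ofReal ((x + t ^ 2)⁻¹) * ENNReal.ofReal ((t ^ 2) ^ (-(1 / 2 : ℝ)))) =
      ENNReal.ofReal (2 / (x + t ^ 2)) := by
    intro t ht
    have ht' : 0 < t := ht
    rw [← ENNReal.ofReal_mul (by positivity), ← ENNReal.ofReal_mul (by positivity)]
    congr 1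
    rw [abs_of_pos (by positivity), show (t ^ 2 : ℝ) = t ^ ((2 : ℕ) : ℝ) by norm_cast,
      ← Real.rpow_mul ht'.le]
    norm_num
    rw [Real.rpow_neg_one]
    field_simp
  rw [setLIntegral_congr_fun measurableSet_Ioi hpt, lintegral_Ioi_two_div_add_sq hx]
  congr 1
  rw [Real.sqrt_eq_rpow, Real.rpow_neg hx.le, div_eq_mul_inv]

/-- The Carleman kernel `(x, y) ↦ (x + y)⁻¹` (as an `ℝ≥0∞`-valued function) is measurable. [folklore] -/
theorem measurable_carlemanKernel :
    Measurable (Function.uncurry fun x y : ℝ => ENNReal.ofReal ((x + y)⁻¹)) := by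
  apply ENNReal.measurable_ofReal.comp
  exact (measurable_fst.add measurable_snd).inv

/-- **Hilbert's inequality, operator form** (Hardy–Littlewood–Pólya, *Inequalities*, Thm. 316 / Carleman's operator):
the positive integral operator with kernel `(x + y)⁻¹` on `(0, ∞)` is bounded on `L²` with norm at most `π`:
`∫₀^∞ (∫₀^∞ f(y)/(x+y) dy)² dx ≤ π² ∫₀^∞ f²` for measurable `f ≥ 0`.  Proof: Schur's test
(`lintegral_rpow_lintegral_le_of_schur`) with the test function `y^{-1/4}` and the row integral
`∫₀^∞ (x+y)⁻¹ y^{-1/2} dy = π x^{-1/2}`. [cite: HardyLittlewoodPolya1952, Thm. 316] -/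
theorem lintegral_Ioi_carleman_rpow_two_le {f : ℝ → ℝ≥0∞} (hf : Measurable f) :
    ∫⁻ x in Ioi (0 : ℝ), (∫⁻ y in Ioi (0 : ℝ), ENNReal.ofReal ((x + y)⁻¹) * f y) ^ (2 : ℝ) ≤
      ENNReal.ofReal π ^ (2 : ℝ) * ∫⁻ y in Ioi (0 : ℝ), f y ^ (2 : ℝ) := by
  set w : ℝ → ℝ≥0∞ := fun y => ENNReal.ofReal (y ^ (-(1 / 4 : ℝ))) with hw
  have hwm : Measurable w := ENNReal.measurable_ofReal.comp (measurable_id.pow_const _)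
  have hw2 : ∀ y : ℝ, 0 < y → w y ^ (2 : ℝ) = ENNReal.ofReal (y ^ (-(1 / 2 : ℝ))) := by
    intro y hy
    rw [hw, ENNReal.ofReal_rpow_of_nonneg (by positivity) (by norm_num), ← Real.rpow_mul hy.le]
    norm_num
  have hw0 : ∀ᵐ y ∂(volume.restrict (Ioi (0 : ℝ))), w y ≠ 0 :=
    (ae_restrict_mem measurableSet_Ioi).mono fun y hy => by
      have : 0 < y := hy
      simp only [hw, ne_eq, ENNReal.ofReal_eq_zero, not_le]
      positivity
  have hwtop : ∀ᵐ y ∂(volume.restrict (Ioi (0 : ℝ))), w y ≠ ⊤ :=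
    ae_of_all _ fun y => ENNReal.ofReal_ne_top
  have hrow : ∀ᵐ x ∂(volume.restrict (Ioi (0 : ℝ))),
      ∫⁻ y in Ioi (0 : ℝ), ENNReal.ofReal ((x + y)⁻¹) * w y ^ (2 : ℝ) ≤ ENNReal.ofReal π * w x ^ (2 : ℝ) :=
    (ae_restrict_mem measurableSet_Ioi).mono fun x hx => by
      have hx' : 0 < x := hx
      rw [setLIntegral_congr_fun measurableSet_Ioi (fun y hy => by rw [hw2 y hy]),
        lintegral_Ioi_inv_add_mul_rpow_neg_half hx', hw2 x hx', ← ENNReal.ofReal_mul Real.pi_pos.le]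
  have hcol : ∀ᵐ y ∂(volume.restrict (Ioi (0 : ℝ))),
      ∫⁻ x in Ioi (0 : ℝ), ENNReal.ofReal ((x + y)⁻¹) * w x ^ (2 : ℝ) ≤ ENNReal.ofReal π * w y ^ (2 : ℝ) :=
    (ae_restrict_mem measurableSet_Ioi).mono fun y hy => by
      have hy' : 0 < y := hy
      rw [setLIntegral_congr_fun measurableSet_Ioi (fun x hx => by rw [hw2 x hx, add_comm]),
        lintegral_Ioi_inv_add_mul_rpow_neg_half hy', hw2 y hy', ← ENNReal.ofReal_mul Real.pi_pos.le]
  have h := lintegral_rpow_lintegral_le_of_schur (μ := volume.restrict (Ioi (0 : ℝ)))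
    (ν := volume.restrict (Ioi (0 : ℝ))) Real.HolderConjugate.two_two measurable_carlemanKernel hwm hwm hw0 hwtop
    hrow hcol hf
  have h22 : (2 : ℝ) / 2 = 1 := by norm_num
  rw [h22, ENNReal.rpow_one] at h
  calc _ ≤ _ := h
    _ = _ := by rw [ENNReal.rpow_two, sq]

/-- **Hilbert's double-integral inequality** (Hardy–Littlewood–Pólya Thm. 316): for measurable `f, g ≥ 0` on `(0,∞)`,
`∫₀^∞ ∫₀^∞ f(x) g(y)/(x+y) dy dx ≤ π ‖f‖₂ ‖g‖₂` (the constant `π` is best possible, not proved here).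
[cite: HardyLittlewoodPolya1952, Thm. 316] -/
theorem lintegral_Ioi_lintegral_Ioi_mul_mul_inv_add_le {f g : ℝ → ℝ≥0∞} (hf : Measurable f) (hg : Measurable g) :
    ∫⁻ x in Ioi (0 : ℝ), ∫⁻ y in Ioi (0 : ℝ), f x * g y * ENNReal.ofReal ((x + y)⁻¹) ≤
      ENNReal.ofReal π * (∫⁻ x in Ioi (0 : ℝ), f x ^ (2 : ℝ)) ^ (1 / 2 : ℝ) *
        (∫⁻ y in Ioi (0 : ℝ), g y ^ (2 : ℝ)) ^ (1 / 2 : ℝ) := by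
  set Kg : ℝ → ℝ≥0∞ := fun x => ∫⁻ y in Ioi (0 : ℝ), ENNReal.ofReal ((x + y)⁻¹) * g y with hKg
  have hKgm : Measurable Kg := by
    have : Measurable (Function.uncurry fun x y : ℝ => ENNReal.ofReal ((x + y)⁻¹) * g y) :=
      measurable_carlemanKernel.mul (hg.comp measurable_snd)
    exact this.lintegral_prod_right
  have hKx : ∀ x : ℝ, Measurable fun y : ℝ => ENNReal.ofReal ((x + y)⁻¹) * g y := fun x =>
    (ENNReal.measurable_ofReal.comp ((measurable_const.add measurable_id).inv)).mul hg
  have hinner : ∀ x, ∫⁻ y in Ioi (0 : ℝ), f x * g y * ENNReal.ofReal ((x + y)⁻¹) = f x * Kg x := by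
    intro x
    simp only [hKg]
    rw [← lintegral_const_mul _ (hKx x)]
    exact lintegral_congr fun y => by ring
  simp_rw [hinner]
  calc ∫⁻ x in Ioi (0 : ℝ), f x * Kg x
      ≤ (∫⁻ x in Ioi (0 : ℝ), f x ^ (2 : ℝ)) ^ (1 / (2 : ℝ)) * (∫⁻ x in Ioi (0 : ℝ), Kg x ^ (2 : ℝ)) ^ (1 / (2 : ℝ)) :=
        ENNReal.lintegral_mul_le_Lp_mul_Lq _ Real.HolderConjugate.two_two hf.aemeasurable hKgm.aemeasurable
    _ ≤ (∫⁻ x in Ioi (0 : ℝ), f x ^ (2 : ℝ)) ^ (1 / (2 : ℝ)) *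
          (ENNReal.ofReal π ^ (2 : ℝ) * ∫⁻ y in Ioi (0 : ℝ), g y ^ (2 : ℝ)) ^ (1 / (2 : ℝ)) := by
        gcongr
        exact lintegral_Ioi_carleman_rpow_two_le hg
    _ = ENNReal.ofReal π * (∫⁻ x in Ioi (0 : ℝ), f x ^ (2 : ℝ)) ^ (1 / 2 : ℝ) *
          (∫⁻ y in Ioi (0 : ℝ), g y ^ (2 : ℝ)) ^ (1 / 2 : ℝ) := by
        rw [ENNReal.mul_rpow_of_nonneg _ _ (by norm_num : (0 : ℝ) ≤ 1 / 2), ← ENNReal.rpow_mul]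
        norm_num
        ring

/-! ## The Laplace transform on `L²(0,∞)`: Carleman form and Hardy's bound `‖𝓛f‖₂ ≤ √π ‖f‖₂` -/

/-- `∫₀^∞ e^{-xs} e^{-ys} ds = (x+y)⁻¹` for `x + y > 0` (`ℝ≥0∞` form). [folklore] -/
theorem lintegral_Ioi_exp_neg_mul_mul_exp_neg_mul {x y : ℝ} (hxy : 0 < x + y) :
    ∫⁻ s in Ioi (0 : ℝ), ENNReal.ofReal (Real.exp (-(x * s))) * ENNReal.ofReal (Real.exp (-(y * s))) =
      ENNReal.ofReal ((x + y)⁻¹) := by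
  have hpt : ∀ s : ℝ, ENNReal.ofReal (Real.exp (-(x * s))) * ENNReal.ofReal (Real.exp (-(y * s))) =
      ENNReal.ofReal (Real.exp (-(x + y) * s)) := fun s => by
    rw [← ENNReal.ofReal_mul (Real.exp_pos _).le, ← Real.exp_add]
    congr 1; congr 1; ring
  simp_rw [hpt]
  have ha : -(x + y) < 0 := by linarith
  rw [← ofReal_integral_eq_lintegral_ofReal (integrableOn_exp_mul_Ioi ha 0)
    ((ae_restrict_mem measurableSet_Ioi).mono fun s _ => (Real.exp_pos _).le), integral_exp_mul_Ioi ha 0]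
  congr 1
  rw [mul_zero, Real.exp_zero]
  field_simp

/-- **The square of the Laplace transform is a Carleman form**: for measurable `f ≥ 0` on `(0,∞)`,
`∫₀^∞ (∫₀^∞ f(x) e^{-xs} dx)² ds = ∫₀^∞∫₀^∞ f(x) f(y) (x+y)⁻¹ dy dx` (Tonelli and
`∫₀^∞ e^{-(x+y)s} ds = (x+y)⁻¹`). [folklore] -/
theorem lintegral_Ioi_laplace_sq_eq {f : ℝ → ℝ≥0∞} (hf : Measurable f) :
    ∫⁻ s in Ioi (0 : ℝ), (∫⁻ x in Ioi (0 : ℝ), f x * ENNReal.ofReal (Real.exp (-(x * s)))) ^ 2 =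
      ∫⁻ x in Ioi (0 : ℝ), ∫⁻ y in Ioi (0 : ℝ), f x * f y * ENNReal.ofReal ((x + y)⁻¹) := by
  -- the kernel e^{-xs} as a measurable function of (x, s)
  have hE : Measurable fun p : ℝ × ℝ => ENNReal.ofReal (Real.exp (-(p.1 * p.2))) :=
    ENNReal.measurable_ofReal.comp (Real.measurable_exp.comp (measurable_fst.mul measurable_snd).neg)
  -- F (s, x, y) := f x e^{-xs} · f y e^{-ys}
  set F : ℝ → ℝ → ℝ → ℝ≥0∞ := fun s x y =>
    (f x * ENNReal.ofReal (Real.exp (-(x * s)))) * (f y * ENNReal.ofReal (Real.exp (-(y * s)))) with hF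
  have hFm : Measurable fun p : ℝ × ℝ × ℝ => F p.1 p.2.1 p.2.2 := by
    simp only [hF]
    refine Measurable.mul ?_ ?_
    · exact (hf.comp (measurable_fst.comp measurable_snd)).mul
        (hE.comp ((measurable_fst.comp measurable_snd).prodMk measurable_fst))
    · exact (hf.comp (measurable_snd.comp measurable_snd)).mul
        (hE.comp ((measurable_snd.comp measurable_snd).prodMk measurable_fst))
  -- step 1: the square as a double integral
  have h1 : ∀ s : ℝ, (∫⁻ x in Ioi (0 : ℝ), f x * ENNReal.ofReal (Real.exp (-(x * s)))) ^ 2 =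
      ∫⁻ x in Ioi (0 : ℝ), ∫⁻ y in Ioi (0 : ℝ), F s x y := by
    intro s
    have hm : AEMeasurable (fun x : ℝ => f x * ENNReal.ofReal (Real.exp (-(x * s)))) (volume.restrict (Ioi 0)) :=
      (hf.mul (hE.comp (measurable_id.prodMk measurable_const))).aemeasurable
    rw [sq, ← lintegral_lintegral_mul hm hm]
  simp_rw [h1]
  -- step 2: Tonelli, moving the `s`-integral inside
  have hswap1 : ∫⁻ s in Ioi (0 : ℝ), ∫⁻ x in Ioi (0 : ℝ), ∫⁻ y in Ioi (0 : ℝ), F s x y =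
      ∫⁻ x in Ioi (0 : ℝ), ∫⁻ s in Ioi (0 : ℝ), ∫⁻ y in Ioi (0 : ℝ), F s x y := by
    refine lintegral_lintegral_swap ?_
    have : Measurable fun p : ℝ × ℝ => ∫⁻ y in Ioi (0 : ℝ), F p.1 p.2 y := by
      have h3 : Measurable fun q : (ℝ × ℝ) × ℝ => F q.1.1 q.1.2 q.2 :=
        hFm.comp ((measurable_fst.comp measurable_fst).prodMk
          ((measurable_snd.comp measurable_fst).prodMk measurable_snd))
      exact h3.lintegral_prod_right
    exact this.aemeasurable
  have hswap2 : ∀ x : ℝ, ∫⁻ s in Ioi (0 : ℝ), ∫⁻ y in Ioi (0 : ℝ), F s x y =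
      ∫⁻ y in Ioi (0 : ℝ), ∫⁻ s in Ioi (0 : ℝ), F s x y := by
    intro x
    refine lintegral_lintegral_swap ?_
    exact (hFm.comp (measurable_fst.prodMk (measurable_const.prodMk measurable_snd))).aemeasurable
  rw [hswap1]
  simp_rw [hswap2]
  -- step 3: the inner `s`-integral
  refine setLIntegral_congr_fun measurableSet_Ioi fun x hx => ?_
  refine setLIntegral_congr_fun measurableSet_Ioi fun y hy => ?_
  have hxy : 0 < x + y := add_pos hx hy
  have hmeas : Measurable fun s : ℝ => ENNReal.ofReal (Real.exp (-(x * s))) * ENNReal.ofReal (Real.exp (-(y * s))) :=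
    (hE.comp (measurable_const.prodMk measurable_id)).mul (hE.comp (measurable_const.prodMk measurable_id))
  calc ∫⁻ s in Ioi (0 : ℝ), F s x y
      = ∫⁻ s in Ioi (0 : ℝ), f x * f y *
          (ENNReal.ofReal (Real.exp (-(x * s))) * ENNReal.ofReal (Real.exp (-(y * s)))) :=
        lintegral_congr fun s => by simp only [hF]; ring
    _ = f x * f y * ENNReal.ofReal ((x + y)⁻¹) := by
        rw [lintegral_const_mul _ hmeas, lintegral_Ioi_exp_neg_mul_mul_exp_neg_mul hxy]

/-- **Hardy's bound for the Laplace transform on `L²(0,∞)`** (a corollary of Hilbert's inequality; HLP Thm. 316 ff.): for measurable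
`f ≥ 0`, `∫₀^∞ (∫₀^∞ f(x)e^{-xs}dx)² ds ≤ π ∫₀^∞ f²`, i.e. `‖𝓛f‖₂ ≤ √π ‖f‖₂`. [cite: HardyLittlewoodPolya1952, Thm. 316] -/
theorem lintegral_Ioi_laplace_sq_le {f : ℝ → ℝ≥0∞} (hf : Measurable f) :
    ∫⁻ s in Ioi (0 : ℝ), (∫⁻ x in Ioi (0 : ℝ), f x * ENNReal.ofReal (Real.exp (-(x * s)))) ^ 2 ≤
      ENNReal.ofReal π * ∫⁻ x in Ioi (0 : ℝ), f x ^ (2 : ℝ) := by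
  rw [lintegral_Ioi_laplace_sq_eq hf]
  calc _ ≤ _ := lintegral_Ioi_lintegral_Ioi_mul_mul_inv_add_le hf hf
    _ = ENNReal.ofReal π * ∫⁻ x in Ioi (0 : ℝ), f x ^ (2 : ℝ) := by
        rw [mul_assoc, ← ENNReal.rpow_add_of_nonneg _ _ (by norm_num : (0 : ℝ) ≤ 1 / 2) (by norm_num)]
        norm_num

end Literature.Analysis.SingularIntegrals

end
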